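import Literature.NumberTheory.LFunctions.HardyZRiemannSiegelEvaluationSharp
import HarnessLib

/-!
# SigmaL / BC5 rung W0 — a banded (multi-point) certified evaluator of the Riemann–Siegel main sum

Route `RiemannHypothesis/HardyZLehmerSplit`, item `SigmaL` (stmt-RiemannHypothesis-24253), tribunal
seat `rh-trib-w-sigmaL-1`. COMPUTATIONAL SUPPORT ONLY: nothing in this file bears on the truth of the
Riemann Hypothesis or of `SigmaL`.

At height `t ≈ 3·10¹²` the main sum `W_N(t) = Σ_{n ≤ N} n^{-1/2-it}` has `N = 691 008` terms and one
interval evaluation (`RSEval.rsW`) costs ≈ 110 s of compiled evaluation; a window certificate needs it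
at > 100 points `t = t₀ + δ`, `|δ| ≤ 25`. This file evaluates ALL such points from ONE pass over `n`
(the classical band-limited Taylor device of large-scale zero computations, in interval arithmetic):
split `1 … N` into blocks `b = [n_b, n_b + s_b)`, put `ℓ_b = log n_b`, `u_n = log n − ℓ_b`,
`c_n = n^{-1/2} e^{-it₀ log n}`; then
`Σ_{n ∈ b} n^{-1/2-i(t₀+δ)} = e^{-iδℓ_b} ( Σ_{j<J} ((−iδ)^j/j!) M_{b,j} + E_b )`,
`M_{b,j} = Σ_{n∈b} c_n u_n^j` (the MOMENTS, computed once: `blockLoop`, `bandMoments`), and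
`|E_b| ≤ (|δ| max_b |u_n|)^J (J+1)/(J!·J) · Σ_{n∈b} n^{-1/2}` for `|δ| |u_n| ≤ 1` (`Complex.exp_bound`);
per point only `#blocks` phases and `J·#blocks` products remain (`taylorSum`, `bandW`).
Main theorem: **`mem_bandW`** — `W_N(t₀+δ) ∈ bandW …` (as `RSEval.Wsum`), for valid `RSEval.RSTables`.

[cite: Gabcke1979, Einleitung (1) p. 2]; [cite: Brent1979, §3]; interval inclusion [folklore].
-/

set_option linter.dupNamespace false
set_option autoImplicit false

open Finset Complex
open Literature.Analysis.ValidatedNumerics Literature.Analysis.ValidatedNumerics.NumericsMP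
open Literature.NumberTheory.LFunctions Literature.NumberTheory.LFunctions.ZetaNumerics
open Literature.NumberTheory.LFunctions.RSEval

namespace Summit.RiemannHypothesis.RiemannHypothesis.Theorems.SigmaLCert

/-! ## 1. The moments of one block and of all blocks -/

/-- Add `p, p·u, p·u², …` entrywise to the list `M`: `M[i] ↦ M[i] + p u^i`. [folklore] -/
def addMoments (S : ℕ) (u : MI) : MC → List MC → List MC
  | _, [] => []
  | p, m :: ms => (m.add p) :: addMoments S u (p.mulMI S u) ms

/-- One block `n, n+1, …, n+c−1` (relative to `Lb ∋ ℓ_b`): accumulate the moments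
`M[j] += c_k u_k^j`, the magnitude sum `B += k^{-1/2}` and `eps = max |u_k|` (scaled).
[cite: Gabcke1979, Einleitung (1) p. 2] -/
def blockLoop (R : RSTables) (t0I Lb : MI) : ℕ → ℕ → List MC → MI → ℤ → Option (List MC × MI × ℤ)
  | _, 0, M, B, eps => some (M, B, eps)
  | n, c + 1, M, B, eps =>
    match MC.expI R.T.S R.T.KI R.T.kI R.T.piI ((MI.mul R.T.S t0I (R.T.logs.getD n default)).neg) with
    | none => none
    | some ph =>
      blockLoop R t0I Lb (n + 1) c
        (addMoments R.T.S ((R.T.logs.getD n default).sub Lb) (ph.mulMI R.T.S (R.mags.getD n default)) M)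
        (B.add (R.mags.getD n default)) (max eps ((R.T.logs.getD n default).sub Lb).absHi)

/-- All blocks from `n` with the given sizes (each `≥ 1`): per block `(Lb, moments, B, eps)`.
[cite: Gabcke1979, Einleitung (1) p. 2] -/
def bandMoments (R : RSTables) (t0I : MI) (J : ℕ) : ℕ → List ℕ → Option (List (MI × List MC × MI × ℤ))
  | _, [] => some []
  | n, sz :: rest =>
    if sz = 0 then none else
    match blockLoop R t0I (R.T.logs.getD n default) n sz (List.replicate J (MC.ofInt R.T.S 0))
        (MI.ofInt R.T.S 0) 0, bandMoments R t0I J (n + sz) rest with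
    | some out, some tail => some ((R.T.logs.getD n default, out.1, out.2.1, out.2.2) :: tail)
    | _, _ => none

/-! ## 2. The evaluation at one point `t₀ + δ` -/

/-- `acc + Σ_i K_{j+i} · M[i]` with `K_j ∋ (−iδ)^j/j!` carried along (`K_{j+1} = K_j (−iδ)/(j+1)`).
[folklore] -/
def taylorSum (S : ℕ) (δI : MI) : ℕ → MC → List MC → MC → MC
  | _, _, [], acc => acc
  | j, K, m :: ms, acc =>
    taylorSum S δI (j + 1) (((K.mulMI S δI).mulNegI).divNat (j + 1)) ms (acc.add (MC.mul S K m))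

/-- **The banded main sum** at `t₀ + δ`: `Σ_b e^{-iδℓ_b} (Σ_j K_j M_{b,j} ± E_b)`,
`E_b ≤ B_b x_b^J (J+1)/(J! J)` with `x_b ≥ |δ| eps_b` (scaled; `none` unless `x_b ≤ 1`).
[cite: Gabcke1979, Einleitung (1) p. 2] -/
def bandW (R : RSTables) (δI : MI) (J : ℕ) : List (MI × List MC × MI × ℤ) → Option MC
  | [] => some (MC.ofInt R.T.S 0)
  | (Lb, M, B, eps) :: rest =>
    match MC.expI R.T.S R.T.KI R.T.kI R.T.piI ((MI.mul R.T.S δI Lb).neg), bandW R δI J rest with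
    | some ph, some acc =>
      let x : ℤ := Numerics.cdiv (δI.absHi * eps) R.T.S
      if 0 ≤ x ∧ x ≤ R.T.S ∧ 0 ≤ B.hi ∧ M.length = J ∧ 0 < J then
        let rad : ℤ :=
          Numerics.cdiv (Numerics.cdiv (B.hi * x ^ J) ((R.T.S : ℤ) ^ J) * (J + 1)) (J.factorial * J)
        some (acc.add (MC.mul R.T.S ph
          ((taylorSum R.T.S δI 0 (MC.ofInt R.T.S 1) M (MC.ofInt R.T.S 0)).widen rad)))
      else none
    | _, _ => none

/-! ## 3. Soundness -/

section Soundness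

/-- `c_n(t₀) = e^{-it₀ log n} · n^{-1/2}`. [folklore] -/
noncomputable def cTerm (t₀ : ℝ) (n : ℕ) : ℂ :=
  Complex.exp ((((-(t₀ * Real.log n)) : ℝ) : ℂ) * I) * ((Real.exp (-(Real.log n / 2)) : ℝ) : ℂ)

/-- `K_j(δ) = (−iδ)^j / j!`. [folklore] -/
noncomputable def kval (δ : ℝ) (j : ℕ) : ℂ := (-(δ : ℂ) * I) ^ j / (j.factorial : ℂ)

/-- Soundness of `addMoments`. [folklore] -/
theorem addMoments_spec {S : ℕ} (hS : 0 < S) {x : ℝ} {u : MI} (hx : MI.mem S x u) (cc : ℂ)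
    (g : ℕ → ℂ) :
    ∀ (ms : List MC) (p : MC) (j0 : ℕ), MC.mem S (cc * (x : ℂ) ^ j0) p →
      (∀ i, i < ms.length → MC.mem S (g (j0 + i)) (ms.getD i default)) →
      (addMoments S u p ms).length = ms.length ∧
        ∀ i, i < ms.length →
          MC.mem S (g (j0 + i) + cc * (x : ℂ) ^ (j0 + i)) ((addMoments S u p ms).getD i default)
  | [], p, j0, _, _ => by simp [addMoments]
  | m :: ms, p, j0, hp, hg => by
    have hp' : MC.mem S (cc * (x : ℂ) ^ (j0 + 1)) (p.mulMI S u) := by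
      have := MC.mem_mulMI hS hp hx
      convert this using 1
      rw [pow_succ]; ring
    have hg' : ∀ i, i < ms.length → MC.mem S (g (j0 + 1 + i)) (ms.getD i default) := by
      intro i hi
      have := hg (i + 1) (by simp; omega)
      rw [List.getD_cons_succ] at this
      rw [show j0 + 1 + i = j0 + (i + 1) by ring]
      exact this
    obtain ⟨hlen, hmem⟩ := addMoments_spec hS hx cc g ms (p.mulMI S u) (j0 + 1) hp' hg'
    refine ⟨by simp [addMoments, hlen], fun i hi ↦ ?_⟩
    cases i with
    | zero =>
      simp only [addMoments, List.getD_cons_zero, add_zero]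
      have h0 := hg 0 (by simp)
      rw [List.getD_cons_zero, add_zero] at h0
      exact MC.mem_add h0 hp
    | succ i =>
      simp only [addMoments, List.getD_cons_succ]
      have := hmem i (by simp at hi; omega)
      rw [show j0 + (i + 1) = j0 + 1 + i by ring]
      exact this

/-- Soundness of `blockLoop` (loop invariant over the block `n, …, n + c − 1`).
[cite: Gabcke1979, Einleitung (1) p. 2] -/
theorem blockLoop_spec {R : RSTables} (hR : R.Valid) {t₀ ℓ : ℝ} {t0I Lb : MI}
    (ht : MI.mem R.T.S t₀ t0I) (hℓ : MI.mem R.T.S ℓ Lb) {J : ℕ} :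
    ∀ (c n : ℕ) (M : List MC) (B : MI) (eps : ℤ) (m : ℕ → ℂ) (β : ℝ)
      {out : List MC × MI × ℤ}, 1 ≤ n → n + c ≤ R.T.N + 1 → M.length = J →
      (∀ j, j < J → MC.mem R.T.S (m j) (M.getD j default)) → MI.mem R.T.S β B →
      blockLoop R t0I Lb n c M B eps = some out →
      out.1.length = J ∧
        (∀ j, j < J → MC.mem R.T.S (m j + ∑ k ∈ range c, cTerm t₀ (n + k) *
          (((Real.log ((n + k : ℕ) : ℝ) - ℓ : ℝ) : ℂ)) ^ j) (out.1.getD j default)) ∧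
        MI.mem R.T.S (β + ∑ k ∈ range c, Real.exp (-(Real.log ((n + k : ℕ) : ℝ) / 2))) out.2.1 ∧
        eps ≤ out.2.2 ∧ (∀ k, k < c → |Real.log ((n + k : ℕ) : ℝ) - ℓ| * R.T.S ≤ out.2.2)
  | 0, n, M, B, eps, m, β, out, _, _, hlen, hM, hB, h => by
    simp only [blockLoop, Option.some.injEq] at h
    subst h
    exact ⟨hlen, fun j hj ↦ by simpa using hM j hj, by simpa using hB, le_rfl, fun k hk ↦ by omega⟩
  | c + 1, n, M, B, eps, m, β, out, hn, hnc, hlen, hM, hB, h => by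
    simp only [blockLoop] at h
    split at h
    · simp at h
    · rename_i ph hph
      have hS := hR.T_valid.S_pos
      have hnN : n ≤ R.T.N := by omega
      have hlogn := hR.T_valid.mem_logs n hn hnN
      have hmagn := hR.mem_mags n hn hnN
      have hph' : MC.mem R.T.S (Complex.exp ((((-(t₀ * Real.log n)) : ℝ) : ℂ) * I)) ph :=
        MC.mem_expI hS hR.T_valid.mem_pi hph (MI.mem_neg (MI.mem_mul hS ht hlogn))
      have hcn : MC.mem R.T.S (cTerm t₀ n) (ph.mulMI R.T.S (R.mags.getD n default)) :=
        MC.mem_mulMI hS hph' hmagn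
      have hu : MI.mem R.T.S (Real.log n - ℓ) ((R.T.logs.getD n default).sub Lb) :=
        MI.mem_sub hlogn hℓ
      -- the new accumulators
      obtain ⟨hlen', hM'⟩ := addMoments_spec hS hu (cTerm t₀ n) m M
        (ph.mulMI R.T.S (R.mags.getD n default)) 0 (by simpa using hcn)
        (fun i hi ↦ by simpa using hM i (hlen ▸ hi))
      have hB' : MI.mem R.T.S (β + Real.exp (-(Real.log n / 2))) (B.add (R.mags.getD n default)) :=
        MI.mem_add hB hmagn
      have hepsu : |Real.log n - ℓ| * R.T.S ≤ ((R.T.logs.getD n default).sub Lb).absHi :=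
        MI.abs_le_absHi hu
      have IH := blockLoop_spec hR ht hℓ c (n + 1) _ _ (max eps ((R.T.logs.getD n default).sub Lb).absHi)
        (fun j ↦ m j + cTerm t₀ n * (((Real.log n - ℓ : ℝ) : ℂ)) ^ j)
        (β + Real.exp (-(Real.log n / 2))) (by omega) (by omega) (hlen'.trans hlen)
        (fun j hj ↦ by simpa using hM' j (by rw [hlen]; exact hj)) hB' h
      obtain ⟨hl, hmom, hBB, heps, hall⟩ := IH
      refine ⟨hl, fun j hj ↦ ?_, ?_, le_trans (le_max_left _ _) heps, fun k hk ↦ ?_⟩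
      · have := hmom j hj
        have e : m j + ∑ k ∈ range (c + 1), cTerm t₀ (n + k) *
              (((Real.log ((n + k : ℕ) : ℝ) - ℓ : ℝ) : ℂ)) ^ j =
            m j + cTerm t₀ n * (((Real.log n - ℓ : ℝ) : ℂ)) ^ j +
              ∑ k ∈ range c, cTerm t₀ (n + 1 + k) *
                (((Real.log ((n + 1 + k : ℕ) : ℝ) - ℓ : ℝ) : ℂ)) ^ j := by
          rw [Finset.sum_range_succ']
          simp only [add_zero]
          rw [add_assoc, add_comm _ (cTerm t₀ n * _)]
          congr 2
          first
            | rfl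
            | exact Finset.sum_congr rfl fun k _ ↦ by rw [show n + (k + 1) = n + 1 + k by ring]
        rw [e]; exact this
      · have e : β + ∑ k ∈ range (c + 1), Real.exp (-(Real.log ((n + k : ℕ) : ℝ) / 2)) =
            β + Real.exp (-(Real.log n / 2)) +
              ∑ k ∈ range c, Real.exp (-(Real.log ((n + 1 + k : ℕ) : ℝ) / 2)) := by
          rw [Finset.sum_range_succ']
          simp only [add_zero]
          rw [add_assoc, add_comm _ (Real.exp (-(Real.log n / 2)))]
          congr 2
          first
            | rfl
            | exact Finset.sum_congr rfl fun k _ ↦ by rw [show n + (k + 1) = n + 1 + k by ring]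
        rw [e]; exact hBB
      · cases k with
        | zero =>
          simp only [add_zero]
          exact hepsu.trans (by exact_mod_cast (le_max_right _ _).trans heps)
        | succ k =>
          have := hall k (by omega)
          rw [show n + (k + 1) = n + 1 + k by ring]
          exact this

/-- Soundness of `taylorSum`. [folklore] -/
theorem taylorSum_spec {S : ℕ} (hS : 0 < S) {δ : ℝ} {δI : MI} (hδ : MI.mem S δ δI) (mv : ℕ → ℂ) :
    ∀ (ms : List MC) (j : ℕ) (K acc : MC) (a : ℂ), MC.mem S (kval δ j) K → MC.mem S a acc →
      (∀ i, i < ms.length → MC.mem S (mv (j + i)) (ms.getD i default)) →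
      MC.mem S (a + ∑ i ∈ range ms.length, kval δ (j + i) * mv (j + i)) (taylorSum S δI j K ms acc)
  | [], j, K, acc, a, _, hacc, _ => by simpa [taylorSum] using hacc
  | m :: ms, j, K, acc, a, hK, hacc, hms => by
    simp only [taylorSum]
    have hK' : MC.mem S (kval δ (j + 1)) (((K.mulMI S δI).mulNegI).divNat (j + 1)) := by
      have := MC.mem_divNat (MC.mem_mulNegI (MC.mem_mulMI hS hK hδ)) (Nat.succ_pos j)
      convert this using 1
      have h1 : (j.factorial : ℂ) ≠ 0 := by exact_mod_cast (Nat.factorial_pos j).ne'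
      have h2 : ((j + 1 : ℕ) : ℂ) ≠ 0 := by exact_mod_cast Nat.succ_ne_zero j
      unfold kval
      rw [pow_succ, Nat.factorial_succ]
      push_cast at h2 ⊢
      field_simp
      try ring
    have hm := hms 0 (by simp)
    rw [List.getD_cons_zero, add_zero] at hm
    have hacc' : MC.mem S (a + kval δ j * mv j) (acc.add (MC.mul S K m)) :=
      MC.mem_add hacc (MC.mem_mul hS hK hm)
    have hms' : ∀ i, i < ms.length → MC.mem S (mv (j + 1 + i)) (ms.getD i default) := by
      intro i hi
      have := hms (i + 1) (by simp; omega)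
      rw [List.getD_cons_succ] at this
      rw [show j + 1 + i = j + (i + 1) by ring]
      exact this
    have := taylorSum_spec hS hδ mv ms (j + 1) _ _ _ hK' hacc' hms'
    have e : a + ∑ i ∈ range (m :: ms).length, kval δ (j + i) * mv (j + i) =
        a + kval δ j * mv j + ∑ i ∈ range ms.length, kval δ (j + 1 + i) * mv (j + 1 + i) := by
      rw [List.length_cons, Finset.sum_range_succ']
      simp only [add_zero]
      rw [add_assoc, add_comm _ (kval δ j * mv j)]
      congr 2
      first
        | rfl
        | exact Finset.sum_congr rfl fun i _ ↦ by rw [show j + (i + 1) = j + 1 + i by ring]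
    rw [e]; exact this

end Soundness

end Summit.RiemannHypothesis.RiemannHypothesis.Theorems.SigmaLCert
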